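import Mathlib
import Summits.AtomisticToContinuum.Crystallization.Theorems.BraggSlacknessRigidityStrictCertificateFlatness

/-!
# Route `NashClassCertificates`, crux `NashNearField` (stmt-AtomisticToContinuum-16827), line `birth`:
# pieces for the stub `stub_localSmoothCertificateOfSitewise` (SITEWISE ⇒ LSC), II — the sharpened one-bond
# Taylor bound on the good window

`stub_ljPairTaylor` (landed, p164648) bounds the first-order Taylor remainder of one Lennard-Jones bond for every
`v ≠ 0`, `‖u‖ ≤ ‖v‖/4`, at the price of the constants `7281, 521` (the perturbed squared length may drop to half of
`‖v‖²`, a factor `2⁸` in the bound on `Ṽ″`).  In the smooth regime of the local smooth certificate the reference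
bonds are read off 1/20-good sites (`‖v‖ ≥ (47/50)(19/20) > 89/100`) and the displacements are `≤ 2ν₁ ≤ 1/25`
(`ν₁ = 1/50`), so the squared length stays above `(9/10)‖v‖²` and the same argument gives

* `stub_ljPairTaylorSharp` — for `‖v‖ ≥ 89/100`, `‖u‖ ≤ 1/25`:
  `|V(‖v+u‖) − V(‖v‖) − (−‖v‖⁻¹⁴ + ‖v‖⁻⁸)⟪v,u⟫| ≤ ‖u‖² (35 ‖v‖⁻¹⁴ + 15 ‖v‖⁻⁸)`
  (`(A+B)² ≤ (1681/400) s B` from `A² ≤ 4 s B`, `B ≤ s/400`; `Ṽ`-Taylor on `[(9/10)s, ∞)`, factor `(10/9)⁸`).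

**The `C_R` this yields for LSC.**  Summed over the matched reference bonds of a radius-8 interior site
(`|u i − u j| ≤ 2ν_i`, so `‖u‖² ≤ 4ν_i²`), the sitewise Cauchy–Born remainder is
`≤ 2ν_i² Σ_q (35 ‖G q‖⁻¹⁴ + 15 ‖G q‖⁻⁸)`; with the unit-template lattice sums `Σ‖q‖⁻¹⁴ ≈ 12.13`, `Σ‖q‖⁻⁸ ≈ 12.80`
this is `C_Taylor ≈ 2·(35·5.11·12.13 + 15·2.54·12.80) ≈ 5.3·10³` when the reference bonds obey the good-window bound
`‖G q‖ ≥ 0.89‖q‖`, and `≈ 2.2·10⁴` with only the tube bound `‖G q‖ ≥ (4/5)‖q‖` (against `4.1·10⁶` from the crude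
constants).  Adding the gauge-defect AM–GM constant `(2c₂,max)²/κ_SW ≈ 26²/κ_SW ≈ 2.3·10³` (`κ_SW ≈ 0.3`) and the
far-field parity constant `≈ 20`, the local smooth certificate should be planned with `C_R ≈ 8·10³` (good window) to
`2.5·10⁴` (tube), i.e. `θ = 1/(2(C_R+1)) ≈ 2·10⁻⁵–6·10⁻⁵` in the lead's composition.  `[folklore]`.
-/

noncomputable section

open scoped BigOperators RealInnerProductSpace
open Literature.MathematicalPhysics.StatisticalMechanics

namespace Summit.AtomisticToContinuum.Crystallization.Theorems.NashClassCertificatesNashNearField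

open Summit.AtomisticToContinuum.Crystallization.Theorems.BraggSlacknessRigidityStrictCertificate in
/-- **Stub piece `stub_ljPairTaylorSharp`: the one-bond Taylor bound on the good window (proved).**  For a bond
`‖v‖ ≥ 89/100` and a perturbation `‖u‖ ≤ 1/25`,
`|V(‖v + u‖) − V(‖v‖) − (−‖v‖⁻¹⁴ + ‖v‖⁻⁸)·⟪v, u⟫| ≤ ‖u‖²·(35 ‖v‖⁻¹⁴ + 15 ‖v‖⁻⁸)`.  Proof: `‖u‖ ≤ ‖v‖/20`, so with
`s = ‖v‖²`, `A = 2⟪v,u⟫`, `B = ‖u‖²`: `|A| ≤ s/10`, `B ≤ s/400`, `A² ≤ 4 s B`, `(A + B)² ≤ (1681/400) s B`, the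
perturbed squared length `s + A + B ≥ (9/10) s`, and the landed second-order Taylor bound for `Ṽ(t) = t⁻⁶/12 − t⁻³/6`
on `[(9/10)s, ∞)` (`abs_tildeV_taylor_le`) together with `|Ṽ′(s)| ≤ (s⁻⁷ + s⁻⁴)/2`. [folklore] -/
theorem stub_ljPairTaylorSharp :
    ∀ (v u : EuclideanSpace ℝ (Fin 3)), 89 / 100 ≤ ‖v‖ → ‖u‖ ≤ 1 / 25 →
      |lennardJones ‖v + u‖ - lennardJones ‖v‖ - (-((‖v‖ ^ 2)⁻¹) ^ 7 + ((‖v‖ ^ 2)⁻¹) ^ 4) * inner ℝ v u| ≤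
        ‖u‖ ^ 2 * (35 * ((‖v‖ ^ 2)⁻¹) ^ 7 + 15 * ((‖v‖ ^ 2)⁻¹) ^ 4) := by
  intro v u hv hu
  set s : ℝ := ‖v‖ ^ 2 with hsdef
  set B : ℝ := ‖u‖ ^ 2 with hBdef
  set A : ℝ := 2 * inner ℝ v u with hAdef
  have hvpos : 0 < ‖v‖ := by linarith
  have hs : 0 < s := by rw [hsdef]; positivity
  have hB0 : 0 ≤ B := by rw [hBdef]; positivity
  have hu0 : 0 ≤ ‖u‖ := norm_nonneg u
  have hu' : ‖u‖ ≤ ‖v‖ / 20 := by linarith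
  -- squared norm of the perturbed bond
  have htp : ‖v + u‖ ^ 2 = s + A + B := by rw [hsdef, hAdef, hBdef, norm_add_sq_real]
  -- the Cauchy–Schwarz facts
  have hinner : |inner ℝ v u| ≤ ‖v‖ * ‖u‖ := abs_real_inner_le_norm v u
  have hvu : ‖v‖ * ‖u‖ ≤ s / 20 := by
    rw [hsdef]
    nlinarith [mul_le_mul_of_nonneg_left hu' hvpos.le]
  have hA : |A| ≤ s / 10 := by
    rw [hAdef, abs_mul, abs_two]
    linarith
  have hA2 : A ^ 2 ≤ 4 * s * B := by
    have h1 : inner ℝ v u ^ 2 ≤ (‖v‖ * ‖u‖) ^ 2 := by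
      rw [← sq_abs]
      exact pow_le_pow_left₀ (abs_nonneg _) hinner 2
    rw [hAdef, hsdef, hBdef]
    nlinarith [h1]
  have hB : B ≤ s / 400 := by
    rw [hBdef, hsdef]
    nlinarith [mul_le_mul hu' hu' hu0 (by positivity : (0 : ℝ) ≤ ‖v‖ / 20)]
  -- the argument stays above `(9/10) s`
  have hm : 0 < 9 / 10 * s := by linarith
  have hss : 9 / 10 * s ≤ s := by linarith
  have htp' : 9 / 10 * s ≤ s + A + B := by have := neg_abs_le A; linarith [abs_nonneg A]
  -- `V = Ṽ ∘ sq`, and the inner product through `A`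
  have hinnerA : inner ℝ v u = A / 2 := by rw [hAdef]; ring
  rw [lennardJones_eq_tildeV_sq ‖v + u‖, lennardJones_eq_tildeV_sq ‖v‖, htp, ← hsdef, hinnerA]
  -- the Taylor bound, with `((9/10) s)⁻¹ = (10/9) s⁻¹`
  have hp := abs_tildeV_taylor_le hm hss htp'
  have hd := abs_tildeV_deriv_le hs
  have hXs : s⁻¹ * s = 1 := inv_mul_cancel₀ hs.ne'
  have hX0 : 0 < s⁻¹ := inv_pos.2 hs
  rw [show (9 / 10 * s)⁻¹ = 10 / 9 * s⁻¹ by rw [mul_inv, inv_div]] at hp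
  have e1 : s + A + B - s = A + B := by ring
  rw [e1] at hp
  -- make the atoms opaque
  clear_value s A B
  generalize hX : s⁻¹ = X at hp hd hXs hX0 ⊢
  set L : ℝ := (7 / 2) * (10 / 9 * X) ^ 8 + 2 * (10 / 9 * X) ^ 5 with hLdef
  set d : ℝ := -(1 / 2) * X ^ 7 + (1 / 2) * X ^ 4 with hddef
  have hL : L = (7 / 2) * (10 / 9) ^ 8 * X ^ 8 + 2 * (10 / 9) ^ 5 * X ^ 5 := by rw [hLdef]; ring
  have hL0 : 0 ≤ L := by rw [hL]; positivity
  -- powers of `X` against `s`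
  have hX8 : X ^ 8 * s = X ^ 7 := by
    calc X ^ 8 * s = X ^ 7 * (X * s) := by ring
      _ = X ^ 7 := by rw [hXs, mul_one]
  have hX5 : X ^ 5 * s = X ^ 4 := by
    calc X ^ 5 * s = X ^ 4 * (X * s) := by ring
      _ = X ^ 4 := by rw [hXs, mul_one]
  -- the quadratic term
  have hquad : L * (A + B) ^ 2 ≤ (69 / 2 * X ^ 7 + 29 / 2 * X ^ 4) * B := by
    have hAB : 2 * A * B ≤ A ^ 2 / 40 + 40 * B ^ 2 := by nlinarith [sq_nonneg (A - 40 * B)]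
    have hBB : B ^ 2 ≤ B * (s / 400) := by
      rw [sq]
      exact mul_le_mul_of_nonneg_left hB hB0
    have h1 : (A + B) ^ 2 ≤ 1681 / 400 * s * B := by nlinarith [hA2, hAB, hBB]
    have h3 := mul_le_mul_of_nonneg_left h1 hL0
    have e : L * (1681 / 400 * s * B) =
        (1681 / 400 * ((7 / 2) * (10 / 9) ^ 8)) * ((X ^ 8 * s) * B) +
          (1681 / 400 * (2 * (10 / 9) ^ 5)) * ((X ^ 5 * s) * B) := by
      rw [hL]; ring
    rw [hX8, hX5] at e
    have hX7B : 0 ≤ X ^ 7 * B := by positivity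
    have hX4B : 0 ≤ X ^ 4 * B := by positivity
    have c1 : (1681 / 400 * ((7 / 2) * (10 / 9) ^ 8) : ℝ) ≤ 69 / 2 := by norm_num
    have c2 : (1681 / 400 * (2 * (10 / 9) ^ 5) : ℝ) ≤ 29 / 2 := by norm_num
    have hfin : L * (1681 / 400 * s * B) ≤ (69 / 2 * X ^ 7 + 29 / 2 * X ^ 4) * B := by
      rw [e]
      have := add_le_add (mul_le_mul_of_nonneg_right c1 hX7B) (mul_le_mul_of_nonneg_right c2 hX4B)
      linarith
    exact h3.trans hfin
  -- the linear term `d · B`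
  have hlin : |d * B| ≤ (1 / 2) * (X ^ 7 + X ^ 4) * B := by
    rw [abs_mul, abs_of_nonneg hB0]
    exact mul_le_mul_of_nonneg_right hd hB0
  obtain ⟨hp1, hp2⟩ := abs_le.1 hp
  obtain ⟨hl1, hl2⟩ := abs_le.1 hlin
  -- the first variation is `d · A`
  have hdA : (-X ^ 7 + X ^ 4) * (A / 2) = d * (A + B) - d * B := by rw [hddef]; ring
  rw [abs_le]
  constructor <;> linarith

end Summit.AtomisticToContinuum.Crystallization.Theorems.NashClassCertificatesNashNearField

end
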